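import Literature.Geometry.Kaehler.ComplexTorusLefschetzFormDegreeOneDualPolarization
import Literature.Geometry.Kaehler.ComplexTorusLefschetzFormDiscriminantGroup
import Literature.Geometry.Kaehler.ComplexTorusPoincarePairingAnyBasis
import Literature.Geometry.Kaehler.ComplexTorusHardLefschetzMinimalClassModPrimeKernel
import Literature.Geometry.Kaehler.ComplexTorusIntegralHardLefschetzModN
import HarnessLib

/-!
# The integral Lefschetz forms of a principally polarised complex torus

Layer `Literature/Geometry/Kaehler`, namespace `Literature.Geometry.Kaehler.ComplexTorus`; lane `lit-hodgefound` (Track 2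
foundations library), seat p09, generation 42, row g42-#7. THEOREMS ONLY (0 definitions); no named fact, net debt 0.

A principal polarisation `η` on the complex torus `X = E/Φ(ℤ^ι)` (`IsPrincipalPolarization Φ η`: a Riemann form with `det E|_Λ = 1`) has type
`(1, …, 1)` (`IsPrincipalPolarization.exists_type_eq_one`), so its MINIMAL classes are `γ_q = θ^{∧q}/q! ∈ H^{2q}(X, ℤ)` (`θ = ofRealForm η`) and
every "constant type" / "`d_g/d₁ = 1`" hypothesis of the library is met. This file specialises the integral structure theory of the
Lefschetz forms `B_k(x, y) = ⟨x, γ_{g−k} ∧ y⟩` (g40–g42) to this case, the one that matters for Jacobians and intermediate Jacobians: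

* §1 DEGREE ONE (`g = k + 1`, `m = θ^{∧(g−1)}/(g−1)!` the minimal curve class): on `H¹(X, ℝ) = {η(v, ·)}`,
  `⟨m, η(v,·) ∧ η(w,·)⟩_e = (−1)^g · sign_X(e) · η(v, w)`, i.e. through `φ_H : E ⥲ Ω̄ = H₁(X̂, ℝ)` **the `H¹` Lefschetz form is `±E^*`, the
  PRINCIPAL polarisation of the dual torus** (`IsPrincipalPolarization.dual`); `B₁(η(v,·), η(w,·)) = ⟨η(v,·), m ∧ η(w,·)⟩ = ± η(v, w)`;
  and **`m ∧ H¹(X, ℤ) = H^{2g−1}(X, ℤ)`** (hard Lefschetz holds over `ℤ` for the minimal class; `g = j + 2`);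
* §2 DEGREE TWO (`g = j + 2`, `γ = θ^{∧(g−2)}/(g−2)!`): `[H^{2g−2}(X, ℤ) : γ ∧ H²(X, ℤ)] = g − 1`, with cokernel AND discriminant group of `B₂`
  both `≅ ℤ/(g−1)`; `γ ∧ H²(X, ℤ) = H^{2g−2}(X, ℤ)` iff `g = 2`; modulo `N`: `[H^{2g−2} : γ ∧ H² + N·H^{2g−2}] = gcd(N, g−1)`; for a prime `p`:
  `γ ∪ (−)` is injective on `H²(X, ℤ/p)` iff `p ∤ g − 1` (`g ≥ 3`), and when `p ∣ g − 1` its kernel is the line `𝔽_p·θ̄` and its image is the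
  annihilator `{z : p ∣ ⟨θ, z⟩}` of `θ`;
* §3 DEGREE THREE: `γ_{g−2} ∧ H³(X, ℤ) = H^{2g−1}(X, ℤ)` (`g = j + 2`: the co-Lefschetz side is ONTO for a principal polarisation), and for
  `g = j + 3`, `γ = θ^{∧(g−3)}/(g−3)!`: `[H^{2g−3}(X, ℤ) : γ ∧ H³(X, ℤ)] = (g−2)^{2g}`, equality iff `g = 3`.

Sources (the statements being made precise over `ℤ`): Lange 2023 §2.1.1 ("A polarization is called principal if it is of type `(1, …, 1)`"),
§2.5.1 Prop. 2.5.1 (PDF p. 129: the dual polarisation; for a principal polarisation `φ_L` is an isomorphism and `L_δ` is principal), §2.5.3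
Thm. 2.5.16 / Cor. 2.5.17 (PDF p. 135), §2.5.4 Exercise (6)(a) (PDF p. 136), §5.4.1 Thm. 5.4.1 and (5.22) (PDF p. 275: hard Lefschetz),
§6.2.4 (PDF p. 310: Poincaré duality over `ℤ`), §4.2 (PDF p. 204); Voisin 2002 §7.1.2 (PDF p. 134 L31), §7.2.2 (PDF p. 142 L10); Benoist–Debarre
2023 §1 (p. 3: "the minimal cohomology class `θ^{g−c}/(g−c)!`" of a principally polarised abelian variety); Conway–Sloane 1999 Ch. 2 §2.4
(PDF p. 162: dual quotient groups); Lang 1982 Ch. VII §5 Thm. 5.2 (pp. 119–120: the transport `E^*`).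

Method: each statement is the library's `IsPolarizationType` statement for the type `(1, …, 1)` (private
`IsPrincipalPolarization.isPolarizationType_one₅₇`), with the content `q!·d₁⋯d_q = q!` and all quotients `d_a/d_b = 1`.

## References

* [cite: Lange2023AbelianVarietiesComplex, §2.1.1; §2.5.1 Prop. 2.5.1 (PDF p. 129); §2.5.3 Thm. 2.5.16 and Cor. 2.5.17 (PDF p. 135);
  §2.5.4 Exercise (6)(a) (PDF p. 136); §5.4.1 Thm. 5.4.1 and (5.22) (PDF p. 275); §6.2.4 (PDF p. 310); §4.2 (PDF p. 204); §1.5.1 (PDF p. 51)]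
* [cite: VoisinHodgeI2002, §7.1.2 (PDF p. 134 L31); §7.2.2 (PDF p. 142 L10)]
* [cite: BenoistDebarre2023SmoothSubvarietiesJacobians, §1 (p. 3)]
* [cite: ConwaySloane1999, Ch. 2 §2.4 (PDF p. 162)]
* [cite: Lang1982AbelianFunctions, Ch. VII §5 Thm. 5.2, pp. 119–120]
-/

noncomputable section

open Module Function
open Literature.LinearAlgebra.Alternating

namespace Literature.Geometry.Kaehler.ComplexTorus

/-! ## §0 Private helpers: a principal polarisation has type `(1, …, 1)` of the right length -/

section Helpers

variable {ι : Type*} [Fintype ι] [DecidableEq ι] {E : Type*} [NormedAddCommGroup E] [NormedSpace ℂ E] {n : ℕ}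
  {η : E [⋀^Fin 2]→L[ℝ] ℝ}

omit [DecidableEq ι] in
/-- `|ι| = n` from an ordering `e : Fin n ≃ ι`. [folklore] -/
private theorem card_eq_of_equiv₅₇ (e : Fin n ≃ ι) : Fintype.card ι = n :=
  (Fintype.card_congr e).symm.trans (Fintype.card_fin n)

/-- A principal polarisation on a lattice of rank `2g` is of type `(1, …, 1) ∈ ℕ^g`. [cite: Lange2023AbelianVarietiesComplex, §2.1.1; §1.5.1 (PDF p. 51)] -/
private theorem IsPrincipalPolarization.isPolarizationType_one₅₇ {Φ : (ι → ℝ) ≃L[ℝ] E} (hp : IsPrincipalPolarization Φ η)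
    {g : ℕ} (hg : Fintype.card ι = 2 * g) : IsPolarizationType Φ η fun _ : Fin g ↦ (1 : ℕ) := by
  obtain ⟨g', d', hd', h1⟩ := hp.exists_type_eq_one
  have hgg : g = g' := by have := hd'.card_eq; omega
  have h := hd'.comp_cast hgg
  have hfun : (fun i : Fin g ↦ d' (Fin.cast hgg i)) = fun _ ↦ 1 := funext fun i ↦ h1 _
  rwa [hfun] at h

omit [Fintype ι] [DecidableEq ι] in
/-- The content of `θ^{∧q}` for the type `(1, …, 1)` is `q!`. [cite: Lange2023AbelianVarietiesComplex, §2.5.3 Thm. 2.5.16 (PDF p. 135)] -/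
private theorem eq_content_smul_of_forall_eq_one₅₇ {g q : ℕ} {d : Fin g → ℕ} (h1 : ∀ i, d i = 1) (hq : q ≤ g)
    {m : E [⋀^Fin (2 * q)]→L[ℝ] ℂ} (hm : wedgePow (ofRealForm η) q = (q.factorial : ℂ) • m) :
    wedgePow (ofRealForm η) q = ((q.factorial * ∏ i : Fin q, d (Fin.castLE hq i) : ℕ) : ℂ) • m := by
  simp only [h1, Finset.prod_const_one, mul_one]
  exact hm

end Helpers

/-! ## §1 Degree one: the `H¹` Lefschetz form of the minimal curve class is `±E^*`, the principal polarisation of `X̂` -/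

section DegreeOne

variable {ι : Type*} [Fintype ι] [DecidableEq ι] {E : Type*} [NormedAddCommGroup E] [NormedSpace ℂ E]
  {k j : ℕ} {η : E [⋀^Fin 2]→L[ℝ] ℝ}

/-- **`⟨θ^{∧(g−1)}/(g−1)!, η(v,·) ∧ η(w,·)⟩_e = (−1)^g · sign_X(e) · η(v, w)`** for a principally polarised complex torus `X` of dimension
`g = k + 1`, any presentation, any orientation `e`: the Lefschetz form of the minimal curve class on `H¹(X, ℝ) = {η(v, ·)}` is `±η⁻¹`
(type `(1, …, 1)`: `d_g = 1` in g42-#5). [cite: Lange2023AbelianVarietiesComplex, §2.5.4 Exercise (6)(a) (PDF p. 136); §2.1.1; §5.4.1 (5.22) (PDF p. 275)] [cite: BenoistDebarre2023SmoothSubvarietiesJacobians, §1 (p. 3)] -/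
theorem IsPrincipalPolarization.poincarePairing_wedgeOne_twoFormLeft_of_eq_factorial_smul {Φ : (ι → ℝ) ≃L[ℝ] E}
    (hp : IsPrincipalPolarization Φ η) (e : Fin (2 * k + 2) ≃ ι) {m : E [⋀^Fin (2 * k)]→L[ℝ] ℂ}
    (hm : wedgePow (ofRealForm η) k = (k.factorial : ℂ) • m) (v w : E) :
    poincarePairing Φ e rfl m (wedgeOne (twoFormLeft η v) (wedgeOne (twoFormLeft η w)
        (ContinuousAlternatingMap.constOfIsEmpty ℝ E (Fin 0) (1 : ℂ))) : E [⋀^Fin 2]→L[ℝ] ℂ) =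
      (-1) ^ (k + 1) * orientationSign Φ e * η ![v, w] := by
  have hd := hp.isPolarizationType_one₅₇ (g := k + 1) (by rw [card_eq_of_equiv₅₇ e]; ring)
  rw [hd.poincarePairing_wedgeOne_twoFormLeft_of_eq_content_smul hp.isRiemannForm e (Nat.le_succ k)
    (eq_content_smul_of_forall_eq_one₅₇ (d := fun _ : Fin (k + 1) ↦ (1 : ℕ)) (fun _ ↦ rfl) (Nat.le_succ k) hm) v w]
  simp only [Nat.cast_one, mul_one]

/-- **`⟨θ^{∧(g−1)}/(g−1)!, Im ξ ∧ Im ζ⟩_e = (−1)^g · sign_X(e) · E^*(ξ, ζ)` for all `ξ, ζ ∈ Ω̄ = H₁(X̂, ℝ)`** (`g = k + 1`): for a principal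
polarisation the `H¹` Lefschetz form of the minimal curve class IS, up to sign, Lang's transport `E^*` — which is the PRINCIPAL polarisation of
the dual torus `X̂` (`IsPrincipalPolarization.dual`). [cite: Lange2023AbelianVarietiesComplex, §2.5.1 Prop. 2.5.1 (PDF p. 129); §2.5.4 Exercise (6)(a) (PDF p. 136); §2.1.1] [cite: Lang1982AbelianFunctions, Ch. VII §5 Thm. 5.2, pp. 119–120] -/
theorem IsPrincipalPolarization.poincarePairing_wedgeOne_imOfAntidual_eq_dualForm_of_eq_factorial_smul {Φ : (ι → ℝ) ≃L[ℝ] E}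
    (hp : IsPrincipalPolarization Φ η) (e : Fin (2 * k + 2) ≃ ι) {m : E [⋀^Fin (2 * k)]→L[ℝ] ℂ}
    (hm : wedgePow (ofRealForm η) k = (k.factorial : ℂ) • m) (ξ ζ : E →L⋆[ℂ] ℂ) :
    poincarePairing Φ e rfl m (wedgeOne (imOfAntidual ξ) (wedgeOne (imOfAntidual ζ)
        (ContinuousAlternatingMap.constOfIsEmpty ℝ E (Fin 0) (1 : ℂ))) : E [⋀^Fin 2]→L[ℝ] ℂ) =
      (-1) ^ (k + 1) * orientationSign Φ e * dualForm Φ hp.isRiemannForm.1 hp.isRiemannForm.nondegenerate ![ξ, ζ] := by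
  have hd := hp.isPolarizationType_one₅₇ (g := k + 1) (by rw [card_eq_of_equiv₅₇ e]; ring)
  rw [hd.poincarePairing_wedgeOne_imOfAntidual_eq_dualForm_of_eq_content_smul hp.isRiemannForm e (Nat.le_succ k)
    (eq_content_smul_of_forall_eq_one₅₇ (d := fun _ : Fin (k + 1) ↦ (1 : ℕ)) (fun _ ↦ rfl) (Nat.le_succ k) hm) ξ ζ]
  simp only [Nat.cast_one, mul_one]

/-- **The `B₁` reading: `⟨η(v,·), θ^{∧(g−1)}/(g−1)! ∧ η(w,·)⟩_e = (−1)^g · sign_X(e) · η(v, w)`** (`g = k + 1`; principal polarisation, any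
presentation). [cite: Lange2023AbelianVarietiesComplex, §2.5.4 Exercise (6)(a) (PDF p. 136); §2.1.1; §5.4.1 (5.22) (PDF p. 275)] [cite: BenoistDebarre2023SmoothSubvarietiesJacobians, §1 (p. 3)] -/
theorem IsPrincipalPolarization.poincarePairing_twoFormLeft_wedge_of_eq_factorial_smul {Φ : (ι → ℝ) ≃L[ℝ] E}
    (hp : IsPrincipalPolarization Φ η) (e : Fin (2 * k + 2) ≃ ι) {m : E [⋀^Fin (2 * k)]→L[ℝ] ℂ}
    (hm : wedgePow (ofRealForm η) k = (k.factorial : ℂ) • m) (h₁ : 1 + (2 * k + 1) = 2 * k + 2) (v w : E) :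
    poincarePairing Φ e h₁ (wedgeSeq (ContinuousAlternatingMap.constOfIsEmpty ℝ E (Fin 0) (1 : ℂ)) 1 fun _ ↦ twoFormLeft η v)
        (m.wedge (wedgeSeq (ContinuousAlternatingMap.constOfIsEmpty ℝ E (Fin 0) (1 : ℂ)) 1 fun _ ↦ twoFormLeft η w)) =
      (-1) ^ (k + 1) * orientationSign Φ e * η ![v, w] := by
  have hd := hp.isPolarizationType_one₅₇ (g := k + 1) (by rw [card_eq_of_equiv₅₇ e]; ring)
  rw [hd.poincarePairing_twoFormLeft_wedge_of_eq_content_smul hp.isRiemannForm e (Nat.le_succ k)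
    (eq_content_smul_of_forall_eq_one₅₇ (d := fun _ : Fin (k + 1) ↦ (1 : ℕ)) (fun _ ↦ rfl) (Nat.le_succ k) hm) h₁ v w]
  simp only [Nat.cast_one, mul_one]

/-- **The `B₁` reading on `Ω̄`: `⟨Im ξ, θ^{∧(g−1)}/(g−1)! ∧ Im ζ⟩_e = (−1)^g · sign_X(e) · E^*(ξ, ζ)`** (`g = k + 1`; principal polarisation).
[cite: Lange2023AbelianVarietiesComplex, §2.5.1 Prop. 2.5.1 (PDF p. 129); §2.5.4 Exercise (6)(a) (PDF p. 136)] [cite: Lang1982AbelianFunctions, Ch. VII §5 Thm. 5.2, pp. 119–120] -/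
theorem IsPrincipalPolarization.poincarePairing_imOfAntidual_wedge_eq_dualForm_of_eq_factorial_smul {Φ : (ι → ℝ) ≃L[ℝ] E}
    (hp : IsPrincipalPolarization Φ η) (e : Fin (2 * k + 2) ≃ ι) {m : E [⋀^Fin (2 * k)]→L[ℝ] ℂ}
    (hm : wedgePow (ofRealForm η) k = (k.factorial : ℂ) • m) (h₁ : 1 + (2 * k + 1) = 2 * k + 2) (ξ ζ : E →L⋆[ℂ] ℂ) :
    poincarePairing Φ e h₁ (wedgeSeq (ContinuousAlternatingMap.constOfIsEmpty ℝ E (Fin 0) (1 : ℂ)) 1 fun _ ↦ imOfAntidual ξ)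
        (m.wedge (wedgeSeq (ContinuousAlternatingMap.constOfIsEmpty ℝ E (Fin 0) (1 : ℂ)) 1 fun _ ↦ imOfAntidual ζ)) =
      (-1) ^ (k + 1) * orientationSign Φ e * dualForm Φ hp.isRiemannForm.1 hp.isRiemannForm.nondegenerate ![ξ, ζ] := by
  have hd := hp.isPolarizationType_one₅₇ (g := k + 1) (by rw [card_eq_of_equiv₅₇ e]; ring)
  rw [hd.poincarePairing_imOfAntidual_wedge_eq_dualForm_of_eq_content_smul hp.isRiemannForm e (Nat.le_succ k)
    (eq_content_smul_of_forall_eq_one₅₇ (d := fun _ : Fin (k + 1) ↦ (1 : ℕ)) (fun _ ↦ rfl) (Nat.le_succ k) hm) h₁ ξ ζ]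
  simp only [Nat.cast_one, mul_one]

/-- **`θ^{∧(g−1)}/(g−1)! ∧ H¹(X, ℤ) = H^{2g−1}(X, ℤ)` for a principally polarised complex torus** (`|ι| = 2g`, `g = j + 2`): hard Lefschetz
holds OVER `ℤ` in degree one for the minimal curve class (the `H¹` Lefschetz form is unimodular; for a general type the index is
`(∏_a d_g/d_a)²`). [cite: Lange2023AbelianVarietiesComplex, §5.4.1 Thm. 5.4.1 and (5.22) (PDF p. 275); §2.1.1; §4.2 (PDF p. 204)] [cite: VoisinHodgeI2002, §7.2.2 (PDF p. 142 L10)] [cite: BenoistDebarre2023SmoothSubvarietiesJacobians, §1 (p. 3)] -/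
theorem IsPrincipalPolarization.map_wedge_integralForms_one_eq_integralForms_of_eq_factorial_smul {Φ : (ι → ℝ) ≃L[ℝ] E}
    (hp : IsPrincipalPolarization Φ η) (hj : Fintype.card ι = 2 * (j + 2)) {m : E [⋀^Fin (2 * (j + 1))]→L[ℝ] ℂ}
    (hm : wedgePow (ofRealForm η) (j + 1) = ((j + 1).factorial : ℂ) • m) :
    (integralForms Φ 1).map (AddMonoidHom.mk'
        (fun x : E [⋀^Fin 1]→L[ℝ] ℂ ↦ (m.wedge x : E [⋀^Fin (2 * j + 3)]→L[ℝ] ℂ)) (ContinuousAlternatingMap.wedge_add_right _)) =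
      integralForms Φ (2 * j + 3) :=
  ((hp.isPolarizationType_one₅₇ hj).map_wedge_integralForms_one_eq_integralForms_iff_of_eq_content_smul hp.isRiemannForm
    (Nat.le_succ _)
    (eq_content_smul_of_forall_eq_one₅₇ (d := fun _ : Fin (j + 2) ↦ (1 : ℕ)) (fun _ ↦ rfl) (Nat.le_succ _) hm)).2 fun _ ↦ rfl

end DegreeOne

/-! ## §2 Degree two: index, cokernel and discriminant group `ℤ/(g−1)`; the form modulo `N` and modulo a prime `p` -/

section DegreeTwo

variable {ι : Type*} [Fintype ι] [DecidableEq ι] {E : Type*} [NormedAddCommGroup E] [NormedSpace ℂ E]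
  {j n : ℕ} {η : E [⋀^Fin 2]→L[ℝ] ℝ}

/-- **`[H^{2g−2}(X, ℤ) : θ^{∧(g−2)}/(g−2)! ∧ H²(X, ℤ)] = g − 1` for a principally polarised complex torus** (`|ι| = 2g`, `g = j + 2`).
[cite: Lange2023AbelianVarietiesComplex, §5.4.1 Thm. 5.4.1 and (5.22) (PDF p. 275); §2.1.1; §2.5.3 Cor. 2.5.17 (PDF p. 135); §4.2 (PDF p. 204)] [cite: VoisinHodgeI2002, §7.1.2 (PDF p. 134 L31)] [cite: BenoistDebarre2023SmoothSubvarietiesJacobians, §1 (p. 3)] -/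
theorem IsPrincipalPolarization.relIndex_map_wedge_integralForms_two_of_eq_factorial_smul {Φ : (ι → ℝ) ≃L[ℝ] E}
    (hp : IsPrincipalPolarization Φ η) (hj : Fintype.card ι = 2 * (j + 2)) {γ : E [⋀^Fin (2 * j)]→L[ℝ] ℂ}
    (hγ : wedgePow (ofRealForm η) j = (j.factorial : ℂ) • γ) :
    ((integralForms Φ 2).map (AddMonoidHom.mk' (fun x : E [⋀^Fin 2]→L[ℝ] ℂ ↦ γ.wedge x)
        (ContinuousAlternatingMap.wedge_add_right _))).relIndex (integralForms Φ (2 * j + 2)) = j + 1 := by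
  have h := (hp.isPolarizationType_one₅₇ hj).relIndex_map_wedge_integralForms_two_of_eq_content_smul hp.isRiemannForm
    (Nat.le_add_right j 2)
    (eq_content_smul_of_forall_eq_one₅₇ (d := fun _ : Fin (j + 2) ↦ (1 : ℕ)) (fun _ ↦ rfl) (Nat.le_add_right j 2) hγ)
  simp only [Nat.div_one, Finset.prod_const_one, one_pow, mul_one] at h
  exact h

/-- **`θ^{∧(g−2)}/(g−2)! ∧ H²(X, ℤ) = H^{2g−2}(X, ℤ)` iff `g = 2`** for a principally polarised complex torus (`|ι| = 2g`, `g = j + 2`).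
[cite: Lange2023AbelianVarietiesComplex, §5.4.1 (5.22) (PDF p. 275); §2.1.1] [cite: VoisinHodgeI2002, §7.1.2 (PDF p. 134 L31)] -/
theorem IsPrincipalPolarization.map_wedge_integralForms_two_eq_integralForms_iff_of_eq_factorial_smul {Φ : (ι → ℝ) ≃L[ℝ] E}
    (hp : IsPrincipalPolarization Φ η) (hj : Fintype.card ι = 2 * (j + 2)) {γ : E [⋀^Fin (2 * j)]→L[ℝ] ℂ}
    (hγ : wedgePow (ofRealForm η) j = (j.factorial : ℂ) • γ) :
    (integralForms Φ 2).map (AddMonoidHom.mk' (fun x : E [⋀^Fin 2]→L[ℝ] ℂ ↦ γ.wedge x)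
        (ContinuousAlternatingMap.wedge_add_right _)) = integralForms Φ (2 * j + 2) ↔ j = 0 :=
  (hp.isPolarizationType_one₅₇ hj).map_wedge_integralForms_two_eq_integralForms_iff_of_eq_content_smul hp.isRiemannForm
    (Nat.le_add_right j 2)
    (eq_content_smul_of_forall_eq_one₅₇ (d := fun _ : Fin (j + 2) ↦ (1 : ℕ)) (fun _ ↦ rfl) (Nat.le_add_right j 2) hγ)

/-- **`H^{2g−2}(X, ℤ)/(θ^{∧(g−2)}/(g−2)! ∧ H²(X, ℤ)) ≅ ℤ/(g−1)`** for a principally polarised complex torus (`|ι| = 2g`, `g = j + 2`).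
[cite: Lange2023AbelianVarietiesComplex, §5.4.1 Thm. 5.4.1 and (5.22) (PDF p. 275); §2.1.1; §4.2 (PDF p. 204)] [cite: VoisinHodgeI2002, §7.1.2 (PDF p. 134 L31)] -/
theorem IsPrincipalPolarization.nonempty_addEquiv_quotient_map_wedge_integralForms_two_zmod_of_eq_factorial_smul
    {Φ : (ι → ℝ) ≃L[ℝ] E} (hp : IsPrincipalPolarization Φ η) (hj : Fintype.card ι = 2 * (j + 2)) {γ : E [⋀^Fin (2 * j)]→L[ℝ] ℂ}
    (hγ : wedgePow (ofRealForm η) j = (j.factorial : ℂ) • γ) :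
    Nonempty (↥(integralForms Φ (2 * j + 2)) ⧸ ((integralForms Φ 2).map (AddMonoidHom.mk' (fun x : E [⋀^Fin 2]→L[ℝ] ℂ ↦ γ.wedge x)
        (ContinuousAlternatingMap.wedge_add_right _))).addSubgroupOf (integralForms Φ (2 * j + 2)) ≃+ ZMod (j + 1)) :=
  (hp.isPolarizationType_one₅₇ hj).nonempty_addEquiv_quotient_map_wedge_integralForms_two_zmod_of_eq_content_smul hp.isRiemannForm
    (Nat.le_add_right j 2)
    (eq_content_smul_of_forall_eq_one₅₇ (d := fun _ : Fin (j + 2) ↦ (1 : ℕ)) (fun _ ↦ rfl) (Nat.le_add_right j 2) hγ) fun _ ↦ rfl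

/-- **The discriminant group of `B₂` is `ℤ/(g−1)`** for a principally polarised complex torus of dimension `g = j + 2`: for ANY `ℤ`-basis `b`
of `H²(X, ℤ)` and the integer Gram matrix `G = (⟨b_i, θ^{∧(g−2)}/(g−2)! ∧ b_{i'}⟩)` (symmetric, even, `|det G| = g − 1`), `ℤ^m/G·ℤ^m ≃+ ℤ/(g−1)`.
[cite: Lange2023AbelianVarietiesComplex, §6.2.4 (PDF p. 310); §5.4.1 (5.22) (PDF p. 275); §2.1.1] [cite: ConwaySloane1999, Ch. 2 §2.4 (PDF p. 162)] [cite: VoisinHodgeI2002, §7.1.2 (PDF p. 134 L31)] -/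
theorem IsPrincipalPolarization.nonempty_addEquiv_quotient_range_mulVecLin_zmod_of_eq_factorial_smul {Φ : (ι → ℝ) ≃L[ℝ] E}
    (hp : IsPrincipalPolarization Φ η) {γ : E [⋀^Fin (2 * j)]→L[ℝ] ℂ} (hγ : wedgePow (ofRealForm η) j = (j.factorial : ℂ) • γ)
    (e : Fin n ≃ ι) (hn : 2 + (2 * j + 2) = n) {μ : Type*} [Fintype μ] [DecidableEq μ] (b : Basis μ ℤ ↥(integralForms Φ 2))
    (G : Matrix μ μ ℤ) (hG : ∀ i i', (G i i' : ℂ) = poincarePairing Φ e hn (b i : E [⋀^Fin 2]→L[ℝ] ℂ) (γ.wedge (b i' : E [⋀^Fin 2]→L[ℝ] ℂ))) :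
    Nonempty (((μ → ℤ) ⧸ LinearMap.range (Matrix.mulVecLin G)) ≃+ ZMod (j + 1)) :=
  (hp.isPolarizationType_one₅₇ (g := j + 2) (by rw [card_eq_of_equiv₅₇ e]; omega))
    |>.nonempty_addEquiv_quotient_range_mulVecLin_zmod_of_eq_content_smul_of_forall_eq hp.isRiemannForm (Nat.le_add_right j 2)
      (eq_content_smul_of_forall_eq_one₅₇ (d := fun _ : Fin (j + 2) ↦ (1 : ℕ)) (fun _ ↦ rfl) (Nat.le_add_right j 2) hγ) (fun _ ↦ rfl) e hn b G hG

/-- **`[H^{2g−2}(X, ℤ) : θ^{∧(g−2)}/(g−2)! ∧ H²(X, ℤ) + N·H^{2g−2}(X, ℤ)] = gcd(N, g − 1)`** for a principally polarised complex torus (`|ι| = 2g`,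
`g = j + 2`): the defect of the minimal class `∪ (−)` on `H²(X, ℤ/N)`. [cite: Lange2023AbelianVarietiesComplex, §5.4.1 (5.22) (PDF p. 275); §2.1.1; §4.2 (PDF p. 204)] [cite: VoisinHodgeI2002, §7.1.2 (PDF p. 134 L31)] -/
theorem IsPrincipalPolarization.relIndex_map_wedge_integralForms_two_sup_map_nsmul_of_eq_factorial_smul {Φ : (ι → ℝ) ≃L[ℝ] E}
    (hp : IsPrincipalPolarization Φ η) (hj : Fintype.card ι = 2 * (j + 2)) {γ : E [⋀^Fin (2 * j)]→L[ℝ] ℂ}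
    (hγ : wedgePow (ofRealForm η) j = (j.factorial : ℂ) • γ) (N : ℕ) :
    ((integralForms Φ 2).map (AddMonoidHom.mk' (fun x : E [⋀^Fin 2]→L[ℝ] ℂ ↦ γ.wedge x) (ContinuousAlternatingMap.wedge_add_right _)) ⊔
        (integralForms Φ (2 * j + 2)).map (nsmulAddMonoidHom N)).relIndex (integralForms Φ (2 * j + 2)) = Nat.gcd N (j + 1) :=
  (hp.isPolarizationType_one₅₇ hj).relIndex_map_wedge_integralForms_two_sup_map_nsmul_of_forall_eq hp.isRiemannForm
    (Nat.le_add_right j 2)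
    (eq_content_smul_of_forall_eq_one₅₇ (d := fun _ : Fin (j + 2) ↦ (1 : ℕ)) (fun _ ↦ rfl) (Nat.le_add_right j 2) hγ) (fun _ ↦ rfl) N

/-- **`g ≥ 3`, `p` prime: `θ^{∧(g−2)}/(g−2)! ∪ (−)` is injective on `H²(X, ℤ/p)` iff `p ∤ g − 1`** (principal polarisation, `|ι| = 2g`,
`g = j + 2`). [cite: Lange2023AbelianVarietiesComplex, §5.4.1 Thm. 5.4.1 and (5.22) (PDF p. 275); §2.5.3 Cor. 2.5.17 (PDF p. 135); §2.1.1] [cite: VoisinHodgeI2002, §7.1.2 (PDF p. 134 L31)] -/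
theorem IsPrincipalPolarization.inf_comap_map_nsmul_eq_map_nsmul_iff_of_eq_factorial_smul {Φ : (ι → ℝ) ≃L[ℝ] E}
    (hp : IsPrincipalPolarization Φ η) (hj : Fintype.card ι = 2 * (j + 2)) (hj₁ : 1 ≤ j) {γ : E [⋀^Fin (2 * j)]→L[ℝ] ℂ}
    (hγ : wedgePow (ofRealForm η) j = (j.factorial : ℂ) • γ) {p : ℕ} (hpr : p.Prime) :
    integralForms Φ 2 ⊓ ((integralForms Φ (2 * j + 2)).map (nsmulAddMonoidHom p)).comap
        (AddMonoidHom.mk' (fun x : E [⋀^Fin 2]→L[ℝ] ℂ ↦ γ.wedge x) (ContinuousAlternatingMap.wedge_add_right _)) =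
      (integralForms Φ 2).map (nsmulAddMonoidHom p) ↔ ¬ p ∣ j + 1 := by
  rw [(hp.isPolarizationType_one₅₇ hj).inf_comap_map_nsmul_eq_map_nsmul_iff_of_eq_content_smul hp.isRiemannForm hj₁
    (Nat.le_add_right j 2)
    (eq_content_smul_of_forall_eq_one₅₇ (d := fun _ : Fin (j + 2) ↦ (1 : ℕ)) (fun _ ↦ rfl) (Nat.le_add_right j 2) hγ) hpr]
  exact ⟨fun h ↦ h.1, fun h ↦ ⟨h, fun h1 ↦ hpr.ne_one (by simpa using h1)⟩⟩

/-- **`p` prime, `p ∣ g − 1`: the kernel of `θ^{∧(g−2)}/(g−2)! ∪ (−)` on `H²(X, ℤ/p)` is the line `𝔽_p·θ̄`** (principal polarisation,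
`|ι| = 2g`, `g = j + 2`): `{x ∈ H²(X, ℤ) : γ ∧ x ∈ p·H^{2g−2}(X, ℤ)} = ℤ·θ + p·H²(X, ℤ)`. [cite: Lange2023AbelianVarietiesComplex, §5.4.1 Thm. 5.4.1 and (5.22) (PDF p. 275); §2.5.3 Cor. 2.5.17 (PDF p. 135); §2.1.1] [cite: VoisinHodgeI2002, §6.2.3 Thm. 6.25 (PDF p. 125); §7.1.2 (PDF p. 134 L31)] -/
theorem IsPrincipalPolarization.inf_comap_map_nsmul_eq_zmultiples_sup_of_eq_factorial_smul {Φ : (ι → ℝ) ≃L[ℝ] E}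
    (hp : IsPrincipalPolarization Φ η) (hj : Fintype.card ι = 2 * (j + 2)) {γ : E [⋀^Fin (2 * j)]→L[ℝ] ℂ}
    (hγ : wedgePow (ofRealForm η) j = (j.factorial : ℂ) • γ) {p : ℕ} (hpr : p.Prime) (hpj : p ∣ j + 1) :
    integralForms Φ 2 ⊓ ((integralForms Φ (2 * j + 2)).map (nsmulAddMonoidHom p)).comap
        (AddMonoidHom.mk' (fun x : E [⋀^Fin 2]→L[ℝ] ℂ ↦ γ.wedge x) (ContinuousAlternatingMap.wedge_add_right _)) =
      AddSubgroup.zmultiples (ofRealForm η : E [⋀^Fin 2]→L[ℝ] ℂ) ⊔ (integralForms Φ 2).map (nsmulAddMonoidHom p) := by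
  have h := (hp.isPolarizationType_one₅₇ hj).inf_comap_map_nsmul_eq_zmultiples_sup_of_forall_eq hp.isRiemannForm
    (Nat.le_add_right j 2)
    (eq_content_smul_of_forall_eq_one₅₇ (d := fun _ : Fin (j + 2) ↦ (1 : ℕ)) (fun _ ↦ rfl) (Nat.le_add_right j 2) hγ) (fun _ ↦ rfl) hpr hpj
  simp only [Nat.cast_one, inv_one, one_smul] at h
  exact h

/-- **`p` prime, `p ∣ g − 1`: the image of `θ^{∧(g−2)}/(g−2)! ∪ (−)` on `H²(X, ℤ/p)` is the annihilator of `θ̄`** (principal polarisation,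
`g = j + 2`, any orientation `e`): `γ ∧ H²(X, ℤ) + p·H^{2g−2}(X, ℤ) = {z ∈ H^{2g−2}(X, ℤ) : p ∣ ⟨θ, z⟩_e}`.
[cite: Lange2023AbelianVarietiesComplex, §6.2.4 (PDF p. 310); §5.4.1 Thm. 5.4.1 and (5.22) (PDF p. 275); §2.5.3 Cor. 2.5.17 (PDF p. 135); §2.1.1] [cite: VoisinHodgeI2002, §6.2.3 Thm. 6.25 (PDF p. 125); §7.1.2 (PDF p. 134 L31)] -/
theorem IsPrincipalPolarization.map_wedge_integralForms_two_sup_map_nsmul_eq_inf_comap_of_eq_factorial_smul {Φ : (ι → ℝ) ≃L[ℝ] E}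
    (hp : IsPrincipalPolarization Φ η) {γ : E [⋀^Fin (2 * j)]→L[ℝ] ℂ} (hγ : wedgePow (ofRealForm η) j = (j.factorial : ℂ) • γ)
    {p : ℕ} (hpr : p.Prime) (hpj : p ∣ j + 1) (e : Fin n ≃ ι) (hn : 2 + (2 * j + 2) = n) :
    (integralForms Φ 2).map (AddMonoidHom.mk' (fun x : E [⋀^Fin 2]→L[ℝ] ℂ ↦ γ.wedge x) (ContinuousAlternatingMap.wedge_add_right _)) ⊔
        (integralForms Φ (2 * j + 2)).map (nsmulAddMonoidHom p) =
      integralForms Φ (2 * j + 2) ⊓ (AddSubgroup.zmultiples (p : ℂ)).comap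
        (poincarePairing Φ e hn (ofRealForm η)).toAddMonoidHom := by
  have h := (hp.isPolarizationType_one₅₇ (g := j + 2) (by rw [card_eq_of_equiv₅₇ e]; omega))
    |>.map_wedge_integralForms_two_sup_map_nsmul_eq_inf_comap_of_forall_eq hp.isRiemannForm (Nat.le_add_right j 2)
      (eq_content_smul_of_forall_eq_one₅₇ (d := fun _ : Fin (j + 2) ↦ (1 : ℕ)) (fun _ ↦ rfl) (Nat.le_add_right j 2) hγ) (fun _ ↦ rfl) hpr hpj e hn
  simp only [Nat.cast_one, inv_one, one_smul] at h
  exact h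

end DegreeTwo

/-! ## §3 Degree three: the co-Lefschetz side is onto; the `H³` Lefschetz form has index `(g−2)^{2g}` -/

section DegreeThree

variable {ι : Type*} [Fintype ι] [DecidableEq ι] {E : Type*} [NormedAddCommGroup E] [NormedSpace ℂ E]
  {j : ℕ} {η : E [⋀^Fin 2]→L[ℝ] ℝ}

/-- **`θ^{∧(g−2)}/(g−2)! ∧ H³(X, ℤ) = H^{2g−1}(X, ℤ)` for a principally polarised complex torus** (`|ι| = 2g`, `g = j + 2`): the co-Lefschetz
cokernel `⊕_x ℤ/(d_{g−1}/d_{min(a(x), g−1)})` vanishes for the type `(1, …, 1)`. [cite: Lange2023AbelianVarietiesComplex, §5.4.1 Thm. 5.4.1 and (5.22) (PDF p. 275); §2.5.3 Thm. 2.5.16 (PDF p. 135); §2.1.1; §4.2 (PDF p. 204)] [cite: VoisinHodgeI2002, §7.1.2 (PDF p. 134 L31)] -/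
theorem IsPrincipalPolarization.map_wedge_integralForms_three_eq_integralForms_of_eq_factorial_smul {Φ : (ι → ℝ) ≃L[ℝ] E}
    (hp : IsPrincipalPolarization Φ η) (hj : Fintype.card ι = 2 * (j + 2)) {γ : E [⋀^Fin (2 * j)]→L[ℝ] ℂ}
    (hγ : wedgePow (ofRealForm η) j = (j.factorial : ℂ) • γ) :
    (integralForms Φ 3).map (AddMonoidHom.mk'
        (fun x : E [⋀^Fin 3]→L[ℝ] ℂ ↦ γ.wedge x) (ContinuousAlternatingMap.wedge_add_right _)) = integralForms Φ (2 * j + 3) :=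
  ((hp.isPolarizationType_one₅₇ hj).map_wedge_integralForms_three_eq_integralForms_iff_of_eq_content_smul hp.isRiemannForm
    (Nat.le_add_right j 2)
    (eq_content_smul_of_forall_eq_one₅₇ (d := fun _ : Fin (j + 2) ↦ (1 : ℕ)) (fun _ ↦ rfl) (Nat.le_add_right j 2) hγ)).2 fun _ ↦ rfl

/-- **`[H^{2g−3}(X, ℤ) : θ^{∧(g−3)}/(g−3)! ∧ H³(X, ℤ)] = (g−2)^{2g}` for a principally polarised complex torus** (`|ι| = 2g`, `g = j + 3`): `1` on a
threefold (`H³(X, ℤ)` is self-dual), `2^8` for `θ ∧ (−) : H³ → H⁵` on a p.p. fourfold, `3^{10}` for `θ^{∧2}/2` on a p.p. fivefold.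
[cite: Lange2023AbelianVarietiesComplex, §5.4.1 Thm. 5.4.1 and (5.22) (PDF p. 275); §2.5.3 Cor. 2.5.17 (PDF p. 135); §2.1.1] [cite: VoisinHodgeI2002, §7.1.2 (PDF p. 134 L31)] [cite: BenoistDebarre2023SmoothSubvarietiesJacobians, §1 (p. 3)] -/
theorem IsPrincipalPolarization.relIndex_map_wedge_integralForms_three_hardLefschetz_of_eq_factorial_smul {Φ : (ι → ℝ) ≃L[ℝ] E}
    (hp : IsPrincipalPolarization Φ η) (hj : Fintype.card ι = 2 * (j + 3)) {γ : E [⋀^Fin (2 * j)]→L[ℝ] ℂ}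
    (hγ : wedgePow (ofRealForm η) j = (j.factorial : ℂ) • γ) :
    ((integralForms Φ 3).map (AddMonoidHom.mk' (fun x : E [⋀^Fin 3]→L[ℝ] ℂ ↦ γ.wedge x)
        (ContinuousAlternatingMap.wedge_add_right _))).relIndex (integralForms Φ (2 * j + 3)) = (j + 1) ^ (2 * (j + 3)) :=
  (hp.isPolarizationType_one₅₇ hj).relIndex_map_wedge_integralForms_three_hardLefschetz_of_eq_content_smul_of_forall_eq
    hp.isRiemannForm (Nat.le_add_right j 3)
    (eq_content_smul_of_forall_eq_one₅₇ (d := fun _ : Fin (j + 3) ↦ (1 : ℕ)) (fun _ ↦ rfl) (Nat.le_add_right j 3) hγ) fun _ ↦ rfl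

/-- **`θ^{∧(g−3)}/(g−3)! ∧ H³(X, ℤ) = H^{2g−3}(X, ℤ)` iff `g = 3`** for a principally polarised complex torus (`|ι| = 2g`, `g = j + 3`).
[cite: Lange2023AbelianVarietiesComplex, §5.4.1 (5.22) (PDF p. 275); §2.1.1] [cite: VoisinHodgeI2002, §7.1.2 (PDF p. 134 L31)] -/
theorem IsPrincipalPolarization.map_wedge_integralForms_three_hardLefschetz_eq_integralForms_iff_of_eq_factorial_smul
    {Φ : (ι → ℝ) ≃L[ℝ] E} (hp : IsPrincipalPolarization Φ η) (hj : Fintype.card ι = 2 * (j + 3)) {γ : E [⋀^Fin (2 * j)]→L[ℝ] ℂ}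
    (hγ : wedgePow (ofRealForm η) j = (j.factorial : ℂ) • γ) :
    (integralForms Φ 3).map (AddMonoidHom.mk' (fun x : E [⋀^Fin 3]→L[ℝ] ℂ ↦ γ.wedge x)
        (ContinuousAlternatingMap.wedge_add_right _)) = integralForms Φ (2 * j + 3) ↔ j = 0 :=
  (hp.isPolarizationType_one₅₇ hj).map_wedge_integralForms_three_hardLefschetz_eq_integralForms_iff_of_eq_content_smul
    hp.isRiemannForm (Nat.le_add_right j 3)
    (eq_content_smul_of_forall_eq_one₅₇ (d := fun _ : Fin (j + 3) ↦ (1 : ℕ)) (fun _ ↦ rfl) (Nat.le_add_right j 3) hγ)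

end DegreeThree

end Literature.Geometry.Kaehler.ComplexTorus
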